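import Summits.Ventures.HodgeRepro2.T5SU11GroundStateTransform

/-!
# The boundary term at infinity against the ground state: `sinh 2R · (Ξ χ_λ′ − χ_λ Ξ′) → 0`

Row 468 showed that the bracket of the decaying solution `χ_λ` against `φ_{λ′}` vanishes at infinity for
`1 < λ′ < λ`; this row is the edge case `λ′ = 1`, `φ_1 = Ξ`. By row 468's identity (with row 338's Lagrange
identity at the parameters `λ, 1`),

  `sinh 2R (Ξ χ_λ′ − χ_λ Ξ′) = (λ(λ−2) + 1) · T_λ(R) ∫_0^R sinh 2t φ_λ Ξ − Ξ(a_R)/φ_λ(a_R)`,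

and both terms tend to `0`: `Ξ/φ_λ ≤ (2/c)(α + βR) e^{(1−λ)R}` (`tendsto_sph_one_hyp_div_atTop`; the linear bound
`e^t Ξ ≤ α + βt` of row 35x against `φ_λ ≥ (c/2) e^{(λ−2)t}` of row 447), and `T_λ(R) ∫_0^R sinh 2t φ_λ Ξ ≤ 2K C₀
e^{−2(λ−1)R} + 2Kc R(α + βR) e^{−(λ−1)R}` (`tendsto_tailIntegral_mul_integral_one`; `R^n e^{−aR} → 0`,
`tendsto_pow_mul_exp_neg_mul_atTop`). Hence **`sinh 2R · (Ξ(a_R) χ_λ′(R) − χ_λ(R) Ξ′(R)) → 0`** for every `λ > 1`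
(`tendsto_green_bracket_decay_one`) — the boundary term of the diagonalisation of the resolvent at the bottom of the
spectrum (next row). Nothing is claimed about (N).

Blind lane: Mathlib + the HodgeRepro2 prefix only; no sorry; axioms ⊆ {propext, Classical.choice,
Quot.sound}.
-/

namespace Summit.Ventures.HodgeRepro2.T5SU11ResolventBoundaryEdge

open Filter Topology MeasureTheory intervalIntegral
open Set (Ioi Ioc)
open T5SU11Cartan T5SU11SphericalFunction T5SU11SphericalBounds T5SU11SphericalContinuous
  T5SU11SphericalAsymptotic T5SU11SphericalCfun T5SU11SphericalUnique T5SU11ReductionOfOrder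
  T5SU11ReductionOfOrderInfinity T5SU11SphericalSolutionSpaceAll T5SU11SphericalDecay
  T5SU11SphericalDecayAsymptotic T5SU11ResolventBoundary T5SU11SphericalDecayBracket T5SU11GroundStateTransform

/-- `R^n e^{−aR} → 0` for `a > 0`. -/
theorem tendsto_pow_mul_exp_neg_mul_atTop (n : ℕ) {a : ℝ} (ha : 0 < a) :
    Tendsto (fun R : ℝ => R ^ n * Real.exp (-a * R)) atTop (𝓝 0) := by
  have h := (Real.tendsto_pow_mul_exp_neg_atTop_nhds_zero n).comp (tendsto_id.const_mul_atTop ha)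
  have h2 := h.div_const (a ^ n)
  rw [zero_div] at h2
  refine h2.congr' (Eventually.of_forall fun R => ?_)
  simp only [Function.comp_def, id]
  have : a ^ n ≠ 0 := pow_ne_zero n ha.ne'
  rw [mul_pow, neg_mul]
  field_simp

section measure

variable [MeasurableSpace Circle] [BorelSpace Circle]

/-- **`Ξ(a_t)/φ_λ(a_t) → 0`** for `λ > 1`. -/
theorem tendsto_sph_one_hyp_div_atTop {lam : ℝ} (hlam : 1 < lam) :
    Tendsto (fun t => sph 1 (hyp t) / sph lam (hyp t)) atTop (𝓝 0) := by
  have hc : 0 < cfun (2 - lam) := cfun_pos (by linarith)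
  obtain ⟨α, β, hα, hβ, hΞle⟩ := exists_exp_mul_sph_one_hyp_le
  have hbound : ∀ᶠ t in atTop, sph 1 (hyp t) / sph lam (hyp t)
      ≤ 2 / cfun (2 - lam) * (α * Real.exp (-(lam - 1) * t) + β * (t * Real.exp (-(lam - 1) * t))) := by
    filter_upwards [eventually_le_sph_hyp hlam, eventually_ge_atTop 0] with t hφ ht0
    have hden : 0 < cfun (2 - lam) / 2 * Real.exp ((lam - 2) * t) := by positivity
    have hΞ : sph 1 (hyp t) ≤ (α + β * t) * Real.exp (-t) := by
      rw [Real.exp_neg, ← div_eq_mul_inv, le_div_iff₀ (Real.exp_pos t), mul_comm]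
      exact hΞle t ht0
    calc sph 1 (hyp t) / sph lam (hyp t)
        ≤ (α + β * t) * Real.exp (-t) / (cfun (2 - lam) / 2 * Real.exp ((lam - 2) * t)) :=
          div_le_div₀ (by positivity) hΞ hden hφ
      _ = 2 / cfun (2 - lam) * (α * Real.exp (-(lam - 1) * t) + β * (t * Real.exp (-(lam - 1) * t))) := by
          rw [show Real.exp (-(lam - 1) * t) = Real.exp (-t) / Real.exp ((lam - 2) * t) by
            rw [← Real.exp_sub]; congr 1; ring]
          field_simp
  have hlower : ∀ᶠ t in atTop, 0 ≤ sph 1 (hyp t) / sph lam (hyp t) :=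
    Eventually.of_forall fun t => div_nonneg (sph_hyp_pos 1 t).le (sph_hyp_pos lam t).le
  have hup : Tendsto (fun t => 2 / cfun (2 - lam)
      * (α * Real.exp (-(lam - 1) * t) + β * (t * Real.exp (-(lam - 1) * t)))) atTop (𝓝 0) := by
    have hA : Tendsto (fun t : ℝ => Real.exp (-(lam - 1) * t)) atTop (𝓝 0) := by
      have := Real.tendsto_exp_atBot.comp (tendsto_id.const_mul_atTop_of_neg (by linarith : -(lam - 1) < 0))
      simpa only [Function.comp_def, id] using this
    have hB := tendsto_mul_exp_neg_mul_atTop (by linarith : 0 < lam - 1)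
    have := ((hA.const_mul α).add (hB.const_mul β)).const_mul (2 / cfun (2 - lam))
    simpa only [mul_zero, add_zero] using this
  exact tendsto_of_tendsto_of_tendsto_of_le_of_le' tendsto_const_nhds hup hlower hbound

/-- **`T_λ(R) · ∫_0^R sinh 2t φ_λ(a_t) Ξ(a_t) dt → 0`** for `λ > 1`. -/
theorem tendsto_tailIntegral_mul_integral_one {lam : ℝ} (hlam : 1 < lam) :
    Tendsto (fun R => tailIntegral (fun t => sph lam (hyp t)) R
      * ∫ t in (0 : ℝ)..R, Real.sinh (2 * t) * sph lam (hyp t) * sph 1 (hyp t)) atTop (𝓝 0) := by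
  have hc : 0 < cfun (2 - lam) := cfun_pos (by linarith)
  set K := 1 / ((lam - 1) * cfun (2 - lam) ^ 2) with hK
  have hKpos : 0 < K := by
    have : 0 < lam - 1 := by linarith
    positivity
  obtain ⟨α, β, hα, hβ, hΞle⟩ := exists_exp_mul_sph_one_hyp_le
  obtain ⟨T₀, hT₀⟩ := eventually_atTop.mp (eventually_sph_hyp_le hlam)
  set M := max T₀ 0 with hM
  set C₀ := ∫ t in (0 : ℝ)..M, Real.sinh (2 * t) * sph lam (hyp t) * sph 1 (hyp t) with hC₀
  have hcont := continuous_integrand lam 1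
  have hnn : ∀ t, 0 ≤ t → 0 ≤ Real.sinh (2 * t) * sph lam (hyp t) * sph 1 (hyp t) := fun t ht =>
    mul_nonneg (mul_nonneg (Real.sinh_nonneg_iff.mpr (by linarith)) (sph_hyp_pos lam t).le) (sph_hyp_pos 1 t).le
  have hC₀nn : 0 ≤ C₀ := integral_nonneg (le_max_right _ _) (fun t ht => hnn t ht.1)
  have hbound : ∀ᶠ R in atTop, tailIntegral (fun t => sph lam (hyp t)) R
      * ∫ t in (0 : ℝ)..R, Real.sinh (2 * t) * sph lam (hyp t) * sph 1 (hyp t)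
      ≤ 2 * K * C₀ * Real.exp (-(2 * (lam - 1)) * R)
        + 2 * K * cfun (2 - lam) * (α * (R * Real.exp (-(lam - 1) * R)) + β * (R ^ 2 * Real.exp (-(lam - 1) * R))) := by
    filter_upwards [eventually_tailIntegral_le hlam, eventually_ge_atTop M, eventually_gt_atTop 0]
      with R hTR hR hR0
    have hT0 : T₀ ≤ R := le_trans (le_max_left _ _) hR
    have hsplit : ∫ t in (0 : ℝ)..R, Real.sinh (2 * t) * sph lam (hyp t) * sph 1 (hyp t)
        = C₀ + ∫ t in M..R, Real.sinh (2 * t) * sph lam (hyp t) * sph 1 (hyp t) := by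
      rw [hC₀, integral_add_adjacent_intervals (hcont.intervalIntegrable _ _) (hcont.intervalIntegrable _ _)]
    have htail_nn : 0 ≤ ∫ t in M..R, Real.sinh (2 * t) * sph lam (hyp t) * sph 1 (hyp t) :=
      integral_nonneg hR (fun t ht => hnn t (le_trans (le_max_right _ _) ht.1))
    have htail : ∫ t in M..R, Real.sinh (2 * t) * sph lam (hyp t) * sph 1 (hyp t)
        ≤ R * (cfun (2 - lam) * ((α + β * R) * Real.exp ((lam - 1) * R))) := by
      have hM' : ∀ t ∈ Set.uIoc M R, ‖Real.sinh (2 * t) * sph lam (hyp t) * sph 1 (hyp t)‖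
          ≤ cfun (2 - lam) * ((α + β * R) * Real.exp ((lam - 1) * R)) := by
        intro t ht
        rw [Set.uIoc_of_le hR] at ht
        have ht0 : 0 ≤ t := le_trans (le_max_right _ _) ht.1.le
        have htT : T₀ ≤ t := le_trans (le_max_left _ _) ht.1.le
        have htR : t ≤ R := ht.2
        have hb1 := hT₀ t htT
        have hΞ : sph 1 (hyp t) ≤ (α + β * t) * Real.exp (-t) := by
          rw [Real.exp_neg, ← div_eq_mul_inv, le_div_iff₀ (Real.exp_pos t), mul_comm]
          exact hΞle t ht0
        have hs : Real.sinh (2 * t) ≤ Real.exp (2 * t) / 2 := sinh_le_exp_div_two _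
        rw [Real.norm_eq_abs, abs_of_nonneg (hnn t ht0)]
        have hexp : Real.exp ((lam - 1) * t) ≤ Real.exp ((lam - 1) * R) :=
          Real.exp_le_exp.mpr (mul_le_mul_of_nonneg_left htR (by linarith))
        have hlin : α + β * t ≤ α + β * R := by nlinarith
        calc Real.sinh (2 * t) * sph lam (hyp t) * sph 1 (hyp t)
            ≤ (Real.exp (2 * t) / 2) * (2 * cfun (2 - lam) * Real.exp ((lam - 2) * t))
              * ((α + β * t) * Real.exp (-t)) :=
              mul_le_mul (mul_le_mul hs hb1 (sph_hyp_pos lam t).le (by positivity)) hΞ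
                (sph_hyp_pos 1 t).le (by positivity)
          _ = cfun (2 - lam) * ((α + β * t) * Real.exp ((lam - 1) * t)) := by
              rw [show Real.exp ((lam - 1) * t)
                  = Real.exp (2 * t) * Real.exp ((lam - 2) * t) * Real.exp (-t) by
                  rw [← Real.exp_add, ← Real.exp_add]; congr 1; ring]
              ring
          _ ≤ cfun (2 - lam) * ((α + β * R) * Real.exp ((lam - 1) * R)) := by
              have : 0 ≤ α + β * t := by positivity
              gcongr
      have hnorm := norm_integral_le_of_norm_le_const hM'
      rw [Real.norm_eq_abs, abs_of_nonneg htail_nn] at hnorm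
      have habs : |R - M| ≤ R := by
        rw [abs_of_nonneg (by linarith)]
        linarith [le_max_right T₀ 0]
      have hcc0 : 0 ≤ cfun (2 - lam) * ((α + β * R) * Real.exp ((lam - 1) * R)) := by positivity
      calc ∫ t in M..R, Real.sinh (2 * t) * sph lam (hyp t) * sph 1 (hyp t)
          ≤ cfun (2 - lam) * ((α + β * R) * Real.exp ((lam - 1) * R)) * |R - M| := hnorm
        _ ≤ cfun (2 - lam) * ((α + β * R) * Real.exp ((lam - 1) * R)) * R := mul_le_mul_of_nonneg_left habs hcc0
        _ = R * (cfun (2 - lam) * ((α + β * R) * Real.exp ((lam - 1) * R))) := by ring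
    have hTnn : 0 ≤ tailIntegral (fun t => sph lam (hyp t)) R := tailIntegral_sph_nonneg hlam hR0
    have hXnn : 0 ≤ C₀ + ∫ t in M..R, Real.sinh (2 * t) * sph lam (hyp t) * sph 1 (hyp t) := by linarith
    have hE : 0 ≤ 2 * K * Real.exp (-(2 * (lam - 1)) * R) := by positivity
    rw [hsplit]
    calc tailIntegral (fun t => sph lam (hyp t)) R
          * (C₀ + ∫ t in M..R, Real.sinh (2 * t) * sph lam (hyp t) * sph 1 (hyp t))
        ≤ (2 * K * Real.exp (-(2 * (lam - 1)) * R))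
          * (C₀ + R * (cfun (2 - lam) * ((α + β * R) * Real.exp ((lam - 1) * R)))) :=
          mul_le_mul hTR (by linarith) hXnn hE
      _ = 2 * K * C₀ * Real.exp (-(2 * (lam - 1)) * R)
          + 2 * K * cfun (2 - lam) * (α * (R * Real.exp (-(lam - 1) * R)) + β * (R ^ 2 * Real.exp (-(lam - 1) * R))) := by
          rw [show Real.exp (-(lam - 1) * R) = Real.exp (-(2 * (lam - 1)) * R) * Real.exp ((lam - 1) * R) by
            rw [← Real.exp_add]; congr 1; ring]
          ring
  have hlower : ∀ᶠ R in atTop, 0 ≤ tailIntegral (fun t => sph lam (hyp t)) R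
      * ∫ t in (0 : ℝ)..R, Real.sinh (2 * t) * sph lam (hyp t) * sph 1 (hyp t) := by
    filter_upwards [eventually_gt_atTop 0] with R hR0
    exact mul_nonneg (tailIntegral_sph_nonneg hlam hR0) (integral_nonneg hR0.le (fun t ht => hnn t ht.1))
  have hup : Tendsto (fun R => 2 * K * C₀ * Real.exp (-(2 * (lam - 1)) * R)
      + 2 * K * cfun (2 - lam) * (α * (R * Real.exp (-(lam - 1) * R)) + β * (R ^ 2 * Real.exp (-(lam - 1) * R))))
      atTop (𝓝 0) := by
    have hA : Tendsto (fun R : ℝ => Real.exp (-(2 * (lam - 1)) * R)) atTop (𝓝 0) := by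
      have := Real.tendsto_exp_atBot.comp (tendsto_id.const_mul_atTop_of_neg (by linarith : -(2 * (lam - 1)) < 0))
      simpa only [Function.comp_def, id] using this
    have hB := tendsto_mul_exp_neg_mul_atTop (by linarith : 0 < lam - 1)
    have hC := tendsto_pow_mul_exp_neg_mul_atTop 2 (by linarith : 0 < lam - 1)
    have := (hA.const_mul (2 * K * C₀)).add (((hB.const_mul α).add (hC.const_mul β)).const_mul
      (2 * K * cfun (2 - lam)))
    simpa only [mul_zero, add_zero] using this
  exact tendsto_of_tendsto_of_tendsto_of_le_of_le' tendsto_const_nhds hup hlower hbound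

/-- **THE BOUNDARY TERM AT INFINITY AGAINST THE GROUND STATE VANISHES**:
`sinh 2R · (Ξ χ_λ′ − χ_λ Ξ′) → 0` for every `λ > 1`. -/
theorem tendsto_green_bracket_decay_one {lam : ℝ} (hlam : 1 < lam) :
    Tendsto (fun R => Real.sinh (2 * R) * (sph 1 (hyp R) * sphDecay' lam R
      - sphDecay lam R * deriv (fun t => sph 1 (hyp t)) R)) atTop (𝓝 0) := by
  have hA := (tendsto_tailIntegral_mul_integral_one hlam).const_mul (lam * (lam - 2) - 1 * (1 - 2))
  have hB := tendsto_sph_one_hyp_div_atTop hlam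
  have h := hA.sub hB
  simp only [mul_zero, sub_zero] at h
  refine h.congr' ?_
  filter_upwards [eventually_gt_atTop 0] with R hR
  have hL := lagrange_identity lam 1 R
  have hφ : sph lam (hyp R) ≠ 0 := (sph_hyp_pos lam R).ne'
  have hS : Real.sinh (2 * R) ≠ 0 := (sinh_two_mul_pos hR).ne'
  rw [sphDecay'_eq hlam hR]
  unfold sphDecay decaySolution
  have e : (lam * (lam - 2) - 1 * (1 - 2)) * (tailIntegral (fun t => sph lam (hyp t)) R
      * ∫ t in (0 : ℝ)..R, Real.sinh (2 * t) * sph lam (hyp t) * sph 1 (hyp t))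
      = tailIntegral (fun t => sph lam (hyp t)) R * ((lam * (lam - 2) - 1 * (1 - 2))
        * ∫ t in (0 : ℝ)..R, Real.sinh (2 * t) * sph lam (hyp t) * sph 1 (hyp t)) := by ring
  rw [e, hL]
  field_simp
  ring

end measure

end Summit.Ventures.HodgeRepro2.T5SU11ResolventBoundaryEdge
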